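import Mathlib.LinearAlgebra.Matrix.Permutation
import Summits.Ventures.HodgeRepro2.T5HermitianDiagonalize

/-!
# Shimura Lemma 1.6, the «if» half, modulo its one local input (cell pub-hodge-repro2, seat p3)

Tier-5 N2 support, row N2.2.2 of route/T5-N2-route-3.md (the NON-split case) and N2.7.1. The printed theorem
(Shimura, Arithmetic of hermitian forms, Doc. Math. 13 (2008), Lemma 1.6, p. 745 ll. 22–23): «Two hermitian spaces
(V, ϕ) and (V′, ϕ′) in the local case are isomorphic if and only if dim(V) = dim(V′) and d₀(ϕ) = d₀(ϕ′)», with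
`d₀` (§1.2, p. 744 ll. 5–7) «the element of F^×/N_{K/F}(K^×) represented by (−1)^{n/2} det(ϕ₀) or
(−1)^{(n−1)/2} det(ϕ₀) according as n is even or odd»; Shimura's proof: «This is well known. For the proof, see
[S2, Proposition 5.3], for example» (p. 745 l. 24; [S2] = Shimura, Euler products and Eisenstein series, CBMS 93).

Files 134 / 135 made the «only if» half and the diagonalisation kernel. This file makes the «if» half kernel
MODULO ONE HYPOTHESIS `(U)`, stated explicitly as a binder (never a display, never claimed here):
**(U) every binary diagonal hermitian form `⟨a, b⟩` over `E/F` represents every `c ∈ F^×`** — the local input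
of every printed proof of Lemma 1.6 (for a non-archimedean local `F` it is the universality of the 4-dimensional
quadratic form `a·N ⊥ b·N`; Jacobowitz, Hermitian forms over local fields, Amer. J. Math. 84 (1962)). Result:
* `isCongruent_of_exists_det_eq`: under `(U)`, two invertible hermitian matrices of the same size whose
  determinants differ by a norm are congruent;
* **`isCongruent_iff_exists_det_eq`** / **`isCongruent_iff_exists_discr_eq`**: under `(U)`, congruence
  `⟺` same `dim` (the type) and same `d₀` in `F^×/N(E^×)` — Lemma 1.6 in kernel modulo `(U)`;
* `neg_one_pow_tri_eq_neg_one_pow_half`: Shimura's sign `(−1)^{⌊n/2⌋}` equals HKS96's `(−1)^{n(n−1)/2}`.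
With `exists_two_classes` (134) and `exists_isHermitian_det_eq` below, the congruence classes of invertible
hermitian matrices of a given size are in bijection with the star-fixed units modulo norms, modulo `(U)`; the
printed «precisely two» (row N2.2.2) then needs only the index formula `(Ḟ_𝔭 : N Ė_𝔓) = 2` — NOT claimed.
Mathlib + files 134 / 135 only. No display; no device. §8(d): uses an L-value-free non-vanishing device: NO.
-/

namespace Summit.Ventures.HodgeRepro2.T5HermitianClassify

open Matrix
open Summit.Ventures.HodgeRepro2.T5HermitianDetClass
open Summit.Ventures.HodgeRepro2.T5HermitianDiagonalize

section Sign

/-- `n(n−1)/2 ≡ ⌊n/2⌋ (mod 2)`: the two printed sign conventions for `d₀` agree. -/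
theorem tri_mod_two (n : ℕ) : n * (n - 1) / 2 % 2 = n / 2 % 2 := by
  induction n using Nat.strong_induction_on with
  | _ n ih =>
    rcases Nat.lt_or_ge n 4 with h | h
    · interval_cases n <;> rfl
    · obtain ⟨m, rfl⟩ : ∃ m, n = m + 4 := ⟨n - 4, by omega⟩
      have h1 : (m + 4) * (m + 4 - 1) / 2 = m * (m - 1) / 2 + (4 * m + 6) := by
        rcases m with _ | m
        · rfl
        · have e1 : m + 1 + 4 - 1 = m + 4 := by omega
          have e2 : m + 1 - 1 = m := by omega
          rw [e1, e2]
          have : (m + 1 + 4) * (m + 4) = (m + 1) * m + 2 * (4 * (m + 1) + 6) := by ring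
          rw [this, Nat.add_mul_div_left _ _ (by norm_num : (0 : ℕ) < 2)]
      have h2 : (m + 4) / 2 = m / 2 + 2 := by omega
      rw [h1, h2, Nat.add_mod, ih m (by omega), ← Nat.add_mod]
      omega

/-- Shimura's `(−1)^{⌊n/2⌋}` (p. 744) is HKS96's `(−1)^{n(n−1)/2}`, in any ring. -/
theorem neg_one_pow_tri_eq_neg_one_pow_half {R : Type*} [Ring R] (n : ℕ) :
    ((-1 : R) ^ (n * (n - 1) / 2)) = (-1) ^ (n / 2) := by
  conv_lhs => rw [neg_one_pow_eq_pow_mod_two]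
  rw [tri_mod_two]
  conv_rhs => rw [neg_one_pow_eq_pow_mod_two]

end Sign

section Tools

variable {E : Type*} [Field E] [StarRing E] {ι : Type*} [Fintype ι] [DecidableEq ι]

omit [DecidableEq ι] in
/-- The form `Pᴴ H P` evaluated on `v` is the form `H` evaluated on `P v`. -/
theorem formVal_conjTranspose_mul_mul (P H : Matrix ι ι E) (v : ι → E) :
    formVal (Pᴴ * H * P) v = formVal H (P *ᵥ v) := by
  unfold formVal
  rw [← mulVec_mulVec, ← mulVec_mulVec, dotProduct_mulVec, ← star_mulVec]

omit [DecidableEq ι] in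
/-- `formVal H 0 = 0`. -/
theorem formVal_zero (H : Matrix ι ι E) : formVal H 0 = 0 := by
  simp [formVal]

/-- On a diagonal matrix, `h(x eᵢ + y eⱼ, x eᵢ + y eⱼ) = N(x) dᵢ + N(y) dⱼ` for `i ≠ j`. -/
theorem formVal_diagonal_single_add_single (d : ι → E) {i j : ι} (hij : i ≠ j) (x y : E) :
    formVal (diagonal d) (Pi.single i x + Pi.single j y) = star x * x * d i + star y * y * d j := by
  unfold formVal
  rw [star_add, ← Pi.single_star, ← Pi.single_star, mulVec_add, add_dotProduct, dotProduct_add,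
    dotProduct_add, single_dotProduct, single_dotProduct, single_dotProduct, single_dotProduct,
    mulVec_single_apply, mulVec_single_apply, mulVec_single_apply, mulVec_single_apply,
    diagonal_apply_eq, diagonal_apply_eq, diagonal_apply_ne _ hij, diagonal_apply_ne _ hij.symm]
  ring

/-- Congruence by a permutation matrix: `H ≅ H.submatrix σ σ`. -/
theorem isCongruent_submatrix_perm (H : Matrix ι ι E) (σ : Equiv.Perm ι) :
    IsCongruent H (H.submatrix σ σ) := by
  refine ⟨(σ⁻¹).permMatrix E, ?_, ?_⟩
  · rw [det_permutation]
    rcases Int.units_eq_one_or (Equiv.Perm.sign σ⁻¹) with h | h <;> simp [h]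
  · rw [conjTranspose_permMatrix, inv_inv]
    show σ.toPEquiv.toMatrix * H * (σ⁻¹).toPEquiv.toMatrix = H.submatrix σ σ
    rw [PEquiv.mul_toMatrix_toPEquiv, PEquiv.toMatrix_toPEquiv_mul, submatrix_submatrix, Equiv.Perm.inv_def,
      Equiv.symm_symm]
    rfl

/-- **Basis completion.** For every `w ≠ 0` and every index `k` there is `H₁ ≅ H` with `H₁ k k = h(w, w)`:
put `w` in column `k'` (where `w k' ≠ 0`) of the identity, then swap `k` and `k'`. -/
theorem exists_isCongruent_apply_eq (H : Matrix ι ι E) {w : ι → E} (hw : w ≠ 0) (k : ι) :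
    ∃ H₁ : Matrix ι ι E, IsCongruent H H₁ ∧ H₁ k k = formVal H w := by
  obtain ⟨k', hk'⟩ := Function.ne_iff.mp hw
  have hk'0 : w k' ≠ 0 := by simpa using hk'
  let P₁ : Matrix ι ι E := 1 + vecMulVec (w - Pi.single k' 1) (Pi.single k' 1)
  have hdet : IsUnit P₁.det := by
    rw [isUnit_iff_ne_zero]
    simp only [P₁]
    rw [vecMulVec_eq Unit, det_one_add_replicateCol_mul_replicateRow, single_dotProduct, one_mul,
      Pi.sub_apply, Pi.single_eq_same]
    simpa using hk'0
  have hcol : P₁ᵀ k' = w := by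
    ext i
    simp [P₁, Matrix.one_apply, vecMulVec_apply, Pi.single_apply]
  refine ⟨(P₁ᴴ * H * P₁).submatrix (Equiv.swap k k') (Equiv.swap k k'),
    IsCongruent.trans (⟨P₁, hdet, rfl⟩ : IsCongruent H (P₁ᴴ * H * P₁))
      (isCongruent_submatrix_perm _ (Equiv.swap k k')), ?_⟩
  rw [submatrix_apply, Equiv.swap_apply_left, conjTranspose_mul_mul_apply_self, hcol]

omit [StarRing E] in
/-- `det (fromBlocks (a) 0 0 S) = a · det S` for a `1 × 1` top-left block. -/
theorem det_fromBlocks_unique {κ : Type*} [Unique κ] [DecidableEq κ] [Fintype κ] {m : Type*} [Fintype m]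
    [DecidableEq m] (a : E) (S : Matrix m m E) :
    (fromBlocks (diagonal fun _ : κ => a) 0 0 S).det = a * S.det := by
  rw [det_fromBlocks_zero₂₁, det_diagonal, Fintype.prod_unique]

end Tools

section Split

variable {E : Type*} [Field E] [StarRing E] {ι : Type*} [Fintype ι] [DecidableEq ι]

/-- **Splitting off a non-zero diagonal entry.** If `H` is hermitian and `H k k ≠ 0`, then
`H ≅ (fromBlocks (H k k) 0 0 S).submatrix e.symm e.symm` for a hermitian `S` on `{i // ¬ i = k}`,
where `e : {i // i = k} ⊕ {i // ¬ i = k} ≃ ι` (the Schur step of file 135 at the index `k`). -/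
theorem exists_isCongruent_split {H : Matrix ι ι E} (hH : H.IsHermitian) (k : ι) (hk : H k k ≠ 0) :
    ∃ S : Matrix { i : ι // ¬ i = k } { i : ι // ¬ i = k } E, S.IsHermitian ∧
      IsCongruent H ((fromBlocks (diagonal fun _ : { i : ι // i = k } => H k k) 0 0 S).submatrix
        (Equiv.sumCompl (fun i => i = k)).symm (Equiv.sumCompl (fun i => i = k)).symm) := by
  obtain ⟨e, he⟩ : ∃ e : { i : ι // i = k } ⊕ { i : ι // ¬ i = k } ≃ ι,
      e = Equiv.sumCompl (fun i => i = k) := ⟨_, rfl⟩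
  obtain ⟨M, hMdef⟩ : ∃ M : Matrix _ _ E, M = H.submatrix e e := ⟨_, rfl⟩
  have hM : M.IsHermitian := by
    rw [hMdef]
    exact (isHermitian_submatrix_equiv e).mpr hH
  have hM' : (fromBlocks M.toBlocks₁₁ M.toBlocks₁₂ M.toBlocks₂₁ M.toBlocks₂₂).IsHermitian := by
    rw [fromBlocks_toBlocks]
    exact hM
  obtain ⟨hA, hBC, -, -⟩ := isHermitian_fromBlocks_iff.mp hM'
  have hA11 : M.toBlocks₁₁ = diagonal fun _ => H k k := by
    rw [eq_diagonal_of_unique M.toBlocks₁₁]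
    congr 1
    ext i
    rw [hMdef, he, Subsingleton.elim i default]
    rfl
  have hAdet : IsUnit M.toBlocks₁₁.det := by
    rw [hA11, det_diagonal, Fintype.prod_unique, isUnit_iff_ne_zero]
    exact hk
  have hschur := isCongruent_fromBlocks_schur M.toBlocks₁₁ M.toBlocks₁₂ M.toBlocks₂₂ hA hAdet
  rw [hBC, fromBlocks_toBlocks] at hschur
  obtain ⟨S, hSdef⟩ : ∃ S : Matrix { i : ι // ¬ i = k } { i : ι // ¬ i = k } E,
      S = M.toBlocks₂₂ - M.toBlocks₂₁ * M.toBlocks₁₁⁻¹ * M.toBlocks₁₂ := ⟨_, rfl⟩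
  rw [← hSdef] at hschur
  have hS : S.IsHermitian := (isHermitian_fromBlocks_iff.mp (hschur.isHermitian hM)).2.2.2
  have hschur' : IsCongruent M (fromBlocks (diagonal fun _ : { i : ι // i = k } => H k k) 0 0 S) := by
    rw [← hA11]
    exact hschur
  refine ⟨S, hS, ?_⟩
  have h3 := isCongruent_submatrix hschur' e.symm
  have hMe : M.submatrix e.symm e.symm = H := by
    rw [hMdef, submatrix_submatrix, Equiv.self_comp_symm, submatrix_id_id]
  rw [hMe] at h3
  rw [← he]
  exact h3

end Split

section Classification

variable {E : Type*} [Field E] [StarRing E]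

/-- The hypothesis `(U)`: every binary diagonal hermitian form `⟨a, b⟩` with `a, b ∈ F^×` represents every
`c ∈ F^×` (`F` = the star-fixed elements). This is the printed local input of Lemma 1.6's proof; it is a
BINDER of the theorems below, never claimed. -/
def BinaryUniversal (E : Type*) [Field E] [StarRing E] : Prop :=
  ∀ a b c : E, star a = a → star b = b → star c = c → a ≠ 0 → b ≠ 0 → c ≠ 0 →
    ∃ x y : E, star x * x * a + star y * y * b = c

/-- Under `(U)`, an invertible hermitian matrix of size `≥ 2` represents every star-fixed `c ≠ 0`:
diagonalise, apply `(U)` to two of the diagonal entries, and transport the vector. -/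
theorem exists_formVal_eq (hμ : ∃ μ : E, μ + star μ ≠ 0) (hU : BinaryUniversal E) {ι : Type*} [Fintype ι]
    [DecidableEq ι] (h2 : 1 < Fintype.card ι) {H : Matrix ι ι E} (hH : H.IsHermitian) (hdet : IsUnit H.det)
    {c : E} (hc : star c = c) (hc0 : c ≠ 0) : ∃ w : ι → E, w ≠ 0 ∧ formVal H w = c := by
  obtain ⟨d, hd, hd0, ⟨P, hP, hPH⟩⟩ := exists_congruent_diagonal_ne_zero hμ H hH hdet
  obtain ⟨i, j, hij⟩ := Fintype.exists_pair_of_one_lt_card h2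
  obtain ⟨x, y, hxy⟩ := hU (d i) (d j) c (hd i) (hd j) hc (hd0 i) (hd0 j) hc0
  refine ⟨P *ᵥ (Pi.single i x + Pi.single j y), ?_, ?_⟩
  · intro h0
    have := formVal_conjTranspose_mul_mul P H (Pi.single i x + Pi.single j y)
    rw [hPH, formVal_diagonal_single_add_single d hij, hxy, h0, formVal_zero] at this
    exact hc0 this
  · rw [← formVal_conjTranspose_mul_mul, hPH, formVal_diagonal_single_add_single d hij, hxy]

/-- The `1 × 1` case: two invertible `1 × 1` hermitian matrices whose entries differ by a norm are congruent. -/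
theorem isCongruent_of_unique {κ : Type*} [Unique κ] [DecidableEq κ] [Fintype κ] {H H' : Matrix κ κ E}
    (h : ∃ u : E, u ≠ 0 ∧ H'.det = star u * u * H.det) : IsCongruent H H' := by
  obtain ⟨u, hu, hdet⟩ := h
  refine ⟨diagonal fun _ => u, ?_, ?_⟩
  · rw [det_diagonal, Fintype.prod_unique, isUnit_iff_ne_zero]
    exact hu
  · ext i j
    rw [det_unique, det_unique] at hdet
    rw [diagonal_conjTranspose, mul_diagonal, diagonal_mul, Subsingleton.elim i default,
      Subsingleton.elim j default, hdet, Pi.star_apply]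
    ring

/-- The induction on the size for Lemma 1.6's «if» half: under `(U)`, invertible hermitian matrices on an index
type of cardinality `n` whose determinants differ by a norm are congruent. -/
theorem isCongruent_of_exists_det_eq_of_card (hμ : ∃ μ : E, μ + star μ ≠ 0) (hU : BinaryUniversal E) :
    ∀ (n : ℕ) {ι : Type*} [Fintype ι] [DecidableEq ι], Fintype.card ι = n →
      ∀ {H H' : Matrix ι ι E}, H.IsHermitian → H'.IsHermitian → IsUnit H.det →
        (∃ u : E, u ≠ 0 ∧ H'.det = star u * u * H.det) → IsCongruent H H' := by
  intro n
  induction n using Nat.strong_induction_on with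
  | _ n ih =>
    intro ι _ _ hn H H' hH hH' hdet hu
    rcases Nat.lt_or_ge n 2 with hlt | hge
    · -- size 0 or 1
      rcases Nat.lt_or_ge n 1 with h0 | h1
      · haveI : IsEmpty ι := Fintype.card_eq_zero_iff.mp (by omega)
        have : H = H' := by
          ext i
          exact (IsEmpty.false i).elim
        rw [this]
        exact isCongruent_refl H'
      · haveI : Unique ι := (Fintype.card_eq_one_iff_nonempty_unique.mp (by omega)).some
        exact isCongruent_of_unique hu
    · -- size ≥ 2: `H'` is diagonalisable; `H` represents its diagonal entry at `k`; split both at `k`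
      obtain ⟨u, hu0, hdetu⟩ := hu
      have hdet' : IsUnit H'.det := by
        rw [hdetu]
        exact ((isUnit_iff_ne_zero.mpr (star_ne_zero.mpr hu0)).mul (isUnit_iff_ne_zero.mpr hu0)).mul hdet
      obtain ⟨d', hd', hd'0, hc'⟩ := exists_congruent_diagonal_ne_zero hμ H' hH' hdet'
      haveI : Nonempty ι := Fintype.card_pos_iff.mp (by omega)
      obtain ⟨k⟩ := ‹Nonempty ι›
      -- `H` represents `a := d' k`
      obtain ⟨w, hw, hwa⟩ := exists_formVal_eq hμ hU (by omega) hH hdet (hd' k) (hd'0 k)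
      obtain ⟨H₁, hH₁, hH₁k⟩ := exists_isCongruent_apply_eq H hw k
      have hH₁herm : H₁.IsHermitian := hH₁.isHermitian hH
      rw [hwa] at hH₁k
      -- split `H₁` and `diagonal d'` at `k`
      obtain ⟨S, hS, hsplit⟩ := exists_isCongruent_split hH₁herm k (by rw [hH₁k]; exact hd'0 k)
      have hd'herm : (diagonal d').IsHermitian :=
        isHermitian_diagonal_iff.mpr fun i => isSelfAdjoint_iff.mpr (hd' i)
      obtain ⟨S', hS', hsplit'⟩ := exists_isCongruent_split hd'herm k
        (by rw [diagonal_apply_eq]; exact hd'0 k)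
      rw [hH₁k] at hsplit
      rw [diagonal_apply_eq] at hsplit'
      -- determinants of the complements differ by a norm
      have hcard : Fintype.card { i : ι // ¬ i = k } = n - 1 := by
        rw [Fintype.card_subtype_compl, Fintype.card_subtype_eq, hn]
      obtain ⟨u₁, hu₁, hdet₁⟩ := (hH₁.trans hsplit).exists_det_eq
      obtain ⟨u₂, hu₂, hdet₂⟩ := (hc'.trans hsplit').exists_det_eq
      rw [det_submatrix_equiv_self, det_fromBlocks_unique] at hdet₁ hdet₂
      have hu₁0 : u₁ ≠ 0 := isUnit_iff_ne_zero.mp hu₁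
      have hu₂0 : u₂ ≠ 0 := isUnit_iff_ne_zero.mp hu₂
      have ha : d' k ≠ 0 := hd'0 k
      have hSdet : IsUnit S.det := by
        rw [isUnit_iff_ne_zero]
        intro h0
        rw [h0, mul_zero] at hdet₁
        rcases mul_eq_zero.mp hdet₁.symm with h | h
        · exact mul_ne_zero (star_ne_zero.mpr hu₁0) hu₁0 h
        · exact (isUnit_iff_ne_zero.mp hdet) h
      have hSS' : ∃ v : E, v ≠ 0 ∧ S'.det = star v * v * S.det := by
        refine ⟨u₂ * u / u₁, div_ne_zero (mul_ne_zero hu₂0 hu0) hu₁0, ?_⟩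
        have key : star u₁ * u₁ * (d' k * S'.det) = star u₂ * u₂ * (star u * u) * (d' k * S.det) := by
          rw [hdet₂, hdet₁, hdetu]
          ring
        have hNu₁ : star u₁ * u₁ ≠ 0 := mul_ne_zero (star_ne_zero.mpr hu₁0) hu₁0
        have hrhs : star (u₂ * u / u₁) * (u₂ * u / u₁) = star u₂ * u₂ * (star u * u) / (star u₁ * u₁) := by
          rw [star_div₀, star_mul', div_mul_div_comm]
          ring
        rw [hrhs, div_mul_eq_mul_div, eq_div_iff hNu₁]
        apply mul_left_cancel₀ ha
        linear_combination key
      have hSS := ih (n - 1) (by omega) hcard hS hS' hSdet hSS'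
      -- assemble
      have hblk := isCongruent_fromBlocks_of_isCongruent (diagonal fun _ : { i : ι // i = k } => d' k) hSS
      have hblk' := isCongruent_submatrix hblk (Equiv.sumCompl (fun i => i = k)).symm
      exact ((hH₁.trans hsplit).trans hblk').trans (hc'.trans hsplit').symm

/-- **Lemma 1.6, «if» half, modulo `(U)`**: invertible hermitian matrices of the same size whose determinants
differ by a norm are congruent. -/
theorem isCongruent_of_exists_det_eq (hμ : ∃ μ : E, μ + star μ ≠ 0) (hU : BinaryUniversal E) {ι : Type*}
    [Fintype ι] [DecidableEq ι] {H H' : Matrix ι ι E} (hH : H.IsHermitian) (hH' : H'.IsHermitian)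
    (hdet : IsUnit H.det) (h : ∃ u : E, u ≠ 0 ∧ H'.det = star u * u * H.det) : IsCongruent H H' :=
  isCongruent_of_exists_det_eq_of_card hμ hU _ rfl hH hH' hdet h

/-- **Shimura Lemma 1.6 in kernel, modulo `(U)`**: two invertible hermitian matrices of the same size are
congruent iff their determinants (equivalently their `d₀`) differ by a norm. -/
theorem isCongruent_iff_exists_det_eq (hμ : ∃ μ : E, μ + star μ ≠ 0) (hU : BinaryUniversal E) {ι : Type*}
    [Fintype ι] [DecidableEq ι] {H H' : Matrix ι ι E} (hH : H.IsHermitian) (hH' : H'.IsHermitian)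
    (hdet : IsUnit H.det) :
    IsCongruent H H' ↔ ∃ u : E, u ≠ 0 ∧ H'.det = star u * u * H.det := by
  constructor
  · intro h
    obtain ⟨u, hu, hdet'⟩ := h.exists_det_eq
    exact ⟨u, isUnit_iff_ne_zero.mp hu, hdet'⟩
  · exact isCongruent_of_exists_det_eq hμ hU hH hH' hdet

/-- The same with Shimura's `d₀ = (−1)^{n(n−1)/2} det`. -/
theorem isCongruent_iff_exists_discr_eq (hμ : ∃ μ : E, μ + star μ ≠ 0) (hU : BinaryUniversal E) {ι : Type*}
    [Fintype ι] [DecidableEq ι] {H H' : Matrix ι ι E} (hH : H.IsHermitian) (hH' : H'.IsHermitian)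
    (hdet : IsUnit H.det) :
    IsCongruent H H' ↔ ∃ u : E, u ≠ 0 ∧ discr H' = star u * u * discr H := by
  rw [isCongruent_iff_exists_det_eq hμ hU hH hH' hdet]
  unfold discr
  constructor
  · rintro ⟨u, hu, h⟩
    exact ⟨u, hu, by rw [h]; ring⟩
  · rintro ⟨u, hu, h⟩
    refine ⟨u, hu, ?_⟩
    have hs : ((-1 : E) ^ (Fintype.card ι * (Fintype.card ι - 1) / 2)) ≠ 0 := pow_ne_zero _ (by simp)
    apply mul_left_cancel₀ hs
    rw [h]
    ring

/-- Every star-fixed unit is the determinant of an invertible hermitian matrix of every size `≥ 1`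
(`diag(a, 1, …, 1)`): with `isCongruent_iff_exists_det_eq`, the congruence classes of invertible hermitian
matrices of size `m + 1` are in bijection with `F^×/N(E^×)` modulo `(U)`. -/
theorem exists_isHermitian_det_eq (m : ℕ) {a : E} (ha : star a = a) :
    ∃ H : Matrix (Fin (m + 1)) (Fin (m + 1)) E, H.IsHermitian ∧ H.det = a :=
  ⟨diagOne a, isHermitian_diagOne ha, det_diagOne a⟩

end Classification

end Summit.Ventures.HodgeRepro2.T5HermitianClassify
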